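import Literature.Probability.LatticeModels.WeightedCurrentsDictionary
import Literature.Probability.LatticeModels.CurrentClusters
import Literature.Probability.LatticeModels.UrsellFourCurrentsProofs
import HarnessLib

/-!
# Random currents with edge-dependent couplings: the switching identities behind the tree diagram bound

Topic `Literature/Probability/LatticeModels`. Consequences of the weighted switching lemma
`Current.etsum_switching` (`WeightedCurrentsSwitching.lean`) in the form used by Aizenman's argument, for
couplings `K ≥ 0` on a finite simple graph `G` (all sums in `ℝ≥0∞`, `Z[A] = ecurrentSum K A`,
`Z_{G₁}[A] = ecurrentSumIn G₁ K A`, `{a,b}` meaning `{a} Δ {b}`):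

* `tsum_epairWeight_switch_pair` — switching a pair `{a,b}` of sources from the second current into the
  first: `∑ 1{∂n₁ = A Δ {a,b}} 1{∂n₂ = {a,b}} w w F(n₁+n₂) = ∑ 1{∂n₁ = A} 1{∂n₂ = ∅} w w F(n₁+n₂) 1{a ↔ b}`;
* `tsum_epairWeight_mul_indicator_mem_cluster` — **the three-point identity** (Panis 2023, §4.1, the display
  "`⟨σ₀σ_u⟩⟨σ_uσ_x⟩/⟨σ₀σ_x⟩ = P^{0x,∅}[0 ↔ u]`" in product form):
  `∑ 1{∂n₁ = {x,y}} 1{∂n₂ = ∅} w w 1{u ∈ C_{n₁+n₂}(x)} = Z[{y,u}] Z[{x,u}]`;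
* `ecurrentSumIn_empty_mul_ecurrentSum_pair` — the restricted two-point switching with its defect term:
  `Z_{G₁}[∅] Z[{z,t}] = Z_{G₁}[{z,t}] Z[∅] + ∑ 1{n₁ ⊆ E(G₁), ∂n₁ = ∅} 1{∂n₂ = {z,t}} w w 1{¬(z ↔ t in E(G₁))}`;
* `ursellFour_currentSum_identity` — **the random-current identity for `U₄`** (Panis 2023, Proposition 4.7,
  `U₄ = -2⟨σ_xσ_y⟩⟨σ_zσ_t⟩ P^{xy,zt}[C(x) ∩ C(z) ≠ ∅]`, in the additive product form
  `Z[xy]Z[zt] + Z[xz]Z[yt] + Z[xt]Z[yz] = Z[xyzt]Z[∅] + 2P`,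
  `P = ∑ 1{∂n₁={x,y}}1{∂n₂={z,t}} w w 1{z ∈ C_{n₁+n₂}(x)}`), from the tree's weight-free pointwise identity
  `Current.ursell_indicator_identity` (`UrsellFourCurrentsProofs.lean`).

## References

* R. Panis, arXiv:2309.05797 (2023), §4.1 (Lemma 4.4 and the two displays after it), §4.2
  (Proposition 4.7) [Panis2023Triviality] (held; read pp. 19–20).
* H. Duminil-Copin, arXiv:1607.06933 (2016), Lemma 2.2, §4.3 eq. (24) [DuminilCopin2016];
  M. Aizenman, Comm. Math. Phys. 86 (1982) [Aizenman1982].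
-/

noncomputable section

open Finset Filter
open scoped symmDiff ENNReal

namespace Literature.Probability.LatticeModels

variable {V : Type*} [Fintype V] [DecidableEq V] {G : SimpleGraph V} [DecidableRel G.Adj]

namespace Current

/-! ### Clusters of sums of currents (`Current.cluster_mono` is in `CurrentClusters.lean`) -/

omit [DecidableEq V] in
/-- Cluster membership is symmetric. [folklore] -/
theorem mem_cluster_comm {n : Current G} {x v : V} : v ∈ n.cluster x ↔ x ∈ n.cluster v := by
  rw [mem_cluster_iff, mem_cluster_iff]
  exact ⟨fun h => h.symm, fun h => h.symm⟩

omit [DecidableEq V] in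
/-- Cluster membership is transitive. [folklore] -/
theorem mem_cluster_trans {n : Current G} {x v w : V} (h1 : v ∈ n.cluster x) (h2 : w ∈ n.cluster v) :
    w ∈ n.cluster x := by
  rw [mem_cluster_iff] at h1 h2 ⊢
  exact h1.trans h2

/-- A current with sources `{a} Δ {b}` connects `a` to `b`. [cite: DuminilCopin2016, §2.1] -/
theorem mem_cluster_of_sources_eq {n : Current G} {a b : V} (hs : n.sources = {a} ∆ {b}) : b ∈ n.cluster a := by
  rw [mem_cluster_iff]
  by_cases hab : a = b
  · subst hab; exact SimpleGraph.Reachable.refl a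
  · exact reachable_of_sources_eq hab hs

/-- If the second current has sources `{a} Δ {b}` then `b ∈ C_{n₁+n₂}(a)`. [cite: DuminilCopin2016, Lemma 2.2] -/
theorem mem_cluster_add_of_sources_eq_right (n₁ : Current G) {n₂ : Current G} {a b : V}
    (hs : n₂.sources = {a} ∆ {b}) : b ∈ (n₁ + n₂).cluster a :=
  cluster_mono (le_add_self : n₂ ≤ n₁ + n₂) a (mem_cluster_of_sources_eq hs)

/-- The connection indicator through the whole graph is the cluster indicator. [folklore] -/
theorem indicator_connIn_self_eq (a b : V) (m : Current G) :
    (connIn G a b).indicator (1 : Current G → ℝ≥0∞) m = if b ∈ m.cluster a then 1 else 0 := by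
  have h : m ∈ connIn G a b ↔ b ∈ m.cluster a := by
    rw [mem_connIn_iff, tracedIn_eq_traced_of_isSupp G (isSupp_self m), mem_cluster_iff]
  by_cases hb : b ∈ m.cluster a
  · rw [Set.indicator_of_mem (h.2 hb), if_pos hb, Pi.one_apply]
  · rw [Set.indicator_of_notMem (fun h' => hb (h.1 h')), if_neg hb]

omit [Fintype V] in
/-- `∅ Δ A = A` for finsets (`bot_symmDiff`). [folklore] -/
theorem empty_symmDiff (A : Finset V) : (∅ : Finset V) ∆ A = A := bot_symmDiff A

omit [Fintype V] in
/-- `(A Δ B) Δ (A Δ C) = B Δ C`. [folklore] -/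
theorem symmDiff_symmDiff_symmDiff_left (A B C : Finset V) : (A ∆ B) ∆ (A ∆ C) = B ∆ C := by
  rw [symmDiff_assoc, symmDiff_left_comm B A C, ← symmDiff_assoc, symmDiff_self, bot_symmDiff]

/-! ### Switching a pair of sources -/

section PairSwitch

variable {K : G.edgeFinset → ℝ}

/-- **Switching a pair of sources into the first current** (Panis 2023, Lemma 4.4 with `B = {a,b}`;
Duminil-Copin 2016, Lemma 2.2): for `K ≥ 0` and `F : Ω → ℝ≥0∞`,
`∑ 1{∂n₁ = A Δ {a,b}} 1{∂n₂ = {a,b}} w w F(n₁+n₂) = ∑ 1{∂n₁ = A} 1{∂n₂ = ∅} w w F(n₁+n₂) 1{b ∈ C_{n₁+n₂}(a)}`.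
[cite: Panis2023Triviality, Lemma 4.4] -/
theorem tsum_epairWeight_switch_pair (hK : ∀ e, 0 ≤ K e) (A : Finset V) (a b : V) (F : Current G → ℝ≥0∞) :
    ∑' p : Current G × Current G, epairWeight K (A ∆ ({a} ∆ {b})) ({a} ∆ {b}) p * F (p.1 + p.2) =
      ∑' p : Current G × Current G,
        epairWeight K A ∅ p * (F (p.1 + p.2) * if b ∈ (p.1 + p.2).cluster a then 1 else 0) := by
  have h := etsum_switching_univ G hK A ∅ a b F
  have hL : ∀ p : Current G × Current G,
      (if IsSupp G p.1 ∧ p.1.sources = A then p.1.eweight K else 0) *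
          (if p.2.sources = ∅ then p.2.eweight K else 0) *
          (F (p.1 + p.2) * (connIn G a b).indicator 1 (p.1 + p.2)) =
        epairWeight K A ∅ p * (F (p.1 + p.2) * if b ∈ (p.1 + p.2).cluster a then 1 else 0) := by
    intro p
    rw [indicator_connIn_self_eq, epairWeight_eq_mul]
    simp only [isSupp_self p.1, true_and]
  have hR : ∀ p : Current G × Current G,
      (if IsSupp G p.1 ∧ p.1.sources = A ∆ ({a} ∆ {b}) then p.1.eweight K else 0) *
          (if p.2.sources = ∅ ∆ ({a} ∆ {b}) then p.2.eweight K else 0) *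
          (F (p.1 + p.2) * (connIn G a b).indicator 1 (p.1 + p.2)) =
        epairWeight K (A ∆ ({a} ∆ {b})) ({a} ∆ {b}) p * F (p.1 + p.2) := by
    intro p
    rw [indicator_connIn_self_eq, epairWeight_eq_mul, empty_symmDiff]
    simp only [isSupp_self p.1, true_and]
    by_cases h2 : p.2.sources = {a} ∆ {b}
    · rw [if_pos (mem_cluster_add_of_sources_eq_right p.1 h2), mul_one]
    · simp only [if_neg h2, mul_zero, zero_mul]
  simp_rw [hL, hR] at h
  exact h.symm

/-- **The three-point identity** (Panis 2023, §4.1: "`⟨σ₀σ_u⟩⟨σ_uσ_x⟩/⟨σ₀σ_x⟩ = P^{0x,∅}[0 ↔ u]`", product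
form): `∑ 1{∂n₁ = {x,y}} 1{∂n₂ = ∅} w w 1{u ∈ C_{n₁+n₂}(x)} = Z[{y,u}] Z[{x,u}]`.
[cite: Panis2023Triviality, §4.1] -/
theorem tsum_epairWeight_mul_indicator_mem_cluster (hK : ∀ e, 0 ≤ K e) (x y u : V) :
    ∑' p : Current G × Current G,
        epairWeight K ({x} ∆ {y}) ∅ p * (if u ∈ (p.1 + p.2).cluster x then 1 else 0) =
      ecurrentSum K ({y} ∆ {u}) * ecurrentSum K ({x} ∆ {u}) := by
  have h := tsum_epairWeight_switch_pair hK ({x} ∆ {y}) x u (fun _ => 1)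
  simp only [one_mul, mul_one] at h
  rw [symmDiff_symmDiff_symmDiff_left] at h
  rw [← h, tsum_epairWeight]

end PairSwitch

/-! ### Restricted two-point switching with defect -/

section Restricted

variable (G₁ : SimpleGraph V) [DecidableRel G₁.Adj] {K : G.edgeFinset → ℝ}

/-- `Z_{G₁}[A] · Z[B]` as a sum over pairs. [folklore] -/
theorem ecurrentSumIn_mul_ecurrentSum (A B : Finset V) :
    ecurrentSumIn G₁ K A * ecurrentSum K B =
      ∑' p : Current G × Current G,
        (if IsSupp G₁ p.1 ∧ p.1.sources = A then p.1.eweight K else 0) *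
          (if p.2.sources = B then p.2.eweight K else 0) := by
  unfold ecurrentSumIn ecurrentSum
  rw [tsum_mul_tsum_eq_tsum_prod]

/-- **Restricted two-point switching with defect** (the switching lemma with the first current supported
on `G₁`, `A = ∅`, `B = {z,t}`, `F = 1`, plus the complementary event):
`Z_{G₁}[∅] Z[{z,t}] = Z_{G₁}[{z,t}] Z[∅] + ∑ 1{n₁ ⊆ E(G₁), ∂n₁ = ∅} 1{∂n₂ = {z,t}} w w 1{¬(z ↔ t in E(G₁) through n₁+n₂)}`.
[cite: AizenmanDuminilCopinSidoraviciusCMP2015, Lemma 2.2] -/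
theorem ecurrentSumIn_empty_mul_ecurrentSum_pair (hK : ∀ e, 0 ≤ K e) (z t : V) :
    ecurrentSumIn G₁ K ∅ * ecurrentSum K ({z} ∆ {t}) =
      ecurrentSumIn G₁ K ({z} ∆ {t}) * ecurrentSum K ∅ +
        ∑' p : Current G × Current G,
          (if IsSupp G₁ p.1 ∧ p.1.sources = ∅ then p.1.eweight K else 0) *
            (if p.2.sources = {z} ∆ {t} then p.2.eweight K else 0) *
            (connIn G₁ z t)ᶜ.indicator 1 (p.1 + p.2) := by
  rw [ecurrentSumIn_mul_ecurrentSum, ecurrentSumIn_mul_ecurrentSum]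
  have hsplit : ∀ p : Current G × Current G,
      (if IsSupp G₁ p.1 ∧ p.1.sources = ∅ then p.1.eweight K else 0) *
          (if p.2.sources = {z} ∆ {t} then p.2.eweight K else 0) =
        (if IsSupp G₁ p.1 ∧ p.1.sources = ∅ then p.1.eweight K else 0) *
            (if p.2.sources = {z} ∆ {t} then p.2.eweight K else 0) *
            (1 * (connIn G₁ z t).indicator 1 (p.1 + p.2)) +
          (if IsSupp G₁ p.1 ∧ p.1.sources = ∅ then p.1.eweight K else 0) *
            (if p.2.sources = {z} ∆ {t} then p.2.eweight K else 0) *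
            (connIn G₁ z t)ᶜ.indicator 1 (p.1 + p.2) := by
    intro p
    have hind : (connIn G₁ z t).indicator (1 : Current G → ℝ≥0∞) (p.1 + p.2) +
        (connIn G₁ z t)ᶜ.indicator 1 (p.1 + p.2) = 1 := by
      rw [← Pi.add_apply, Set.indicator_self_add_compl, Pi.one_apply]
    rw [one_mul, ← mul_add, hind, mul_one]
  rw [tsum_congr hsplit, ENNReal.tsum_add, etsum_switching_univ G₁ hK ∅ ({z} ∆ {t}) z t (fun _ => 1)]
  congr 1
  refine tsum_congr fun p => ?_
  rw [empty_symmDiff, symmDiff_self, Finset.bot_eq_empty, one_mul]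
  by_cases h1 : IsSupp G₁ p.1 ∧ p.1.sources = {z} ∆ {t}
  · rw [if_pos h1, Set.indicator_of_mem (add_mem_connIn_of_sources_eq G₁ h1.1 h1.2 p.2),
      Pi.one_apply, mul_one]
  · simp only [if_neg h1, zero_mul]

end Restricted

/-! ### The random-current identity for `U₄` -/

section Ursell

variable {K : G.edgeFinset → ℝ}

/-- The pointwise identity behind Proposition 4.7, `ℝ≥0∞` form of the tree's
`Current.ursell_indicator_identity`: if `∂n = {x} Δ {y} Δ {z} Δ {t}` then
`1{t∈C(z)} + 1{t∈C(y)} + 1{z∈C(y)} = 1 + 2·1{z∈C(x)}1{t∈C(z)}`. [cite: DuminilCopin2016, §4.3, eq. (24)] -/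
theorem ursell_indicator_identity_ennreal {n : Current G} {x y z t : V}
    (hn : n.sources = {x} ∆ ({y} ∆ ({z} ∆ {t}))) :
    ((if t ∈ n.cluster z then 1 else 0) + (if t ∈ n.cluster y then 1 else 0) +
        (if z ∈ n.cluster y then 1 else 0) : ℝ≥0∞) =
      1 + 2 * ((if z ∈ n.cluster x then 1 else 0) * (if t ∈ n.cluster z then 1 else 0)) := by
  have h := ursell_indicator_identity hn
  by_cases hzt : (Percolation.openGraph n.traced).Reachable z t <;>
    by_cases hyt : (Percolation.openGraph n.traced).Reachable y t <;>
    by_cases hyz : (Percolation.openGraph n.traced).Reachable y z <;>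
    by_cases hxz : (Percolation.openGraph n.traced).Reachable x z <;>
    simp only [hzt, hyt, hyz, hxz, if_true, if_false, mem_cluster_iff] at h ⊢ <;>
    first | (exfalso; norm_num at h; done) | norm_num

/-- **The random-current identity for `U₄`** (Aizenman 1982; Panis 2023, Proposition 4.7:
`U₄(x,y,z,t) = -2⟨σ_xσ_y⟩⟨σ_zσ_t⟩ P^{xy,zt}[C_{n₁+n₂}(x) ∩ C_{n₁+n₂}(z) ≠ ∅]`), additive product form for
couplings `K ≥ 0` on a finite graph:
`Z[xy]Z[zt] + Z[xz]Z[yt] + Z[xt]Z[yz] = Z[{x}Δ{y}Δ{z}Δ{t}] Z[∅] + 2P`,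
`P = ∑ 1{∂n₁={x,y}} 1{∂n₂={z,t}} w w 1{z ∈ C_{n₁+n₂}(x)}` (so that `U₄ Z[∅]² = -2P`; on `{∂n₂ = {z,t}}` the
clusters of `x` and `z` meet iff `z ∈ C(x)`). [cite: Panis2023Triviality, Proposition 4.7] -/
theorem ursellFour_currentSum_identity (hK : ∀ e, 0 ≤ K e) (x y z t : V) :
    ecurrentSum K ({x} ∆ {y}) * ecurrentSum K ({z} ∆ {t}) +
        ecurrentSum K ({x} ∆ {z}) * ecurrentSum K ({y} ∆ {t}) +
        ecurrentSum K ({x} ∆ {t}) * ecurrentSum K ({y} ∆ {z}) =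
      ecurrentSum K ({x} ∆ ({y} ∆ ({z} ∆ {t}))) * ecurrentSum K ∅ +
        2 * ∑' p : Current G × Current G,
          epairWeight K ({x} ∆ {y}) ({z} ∆ {t}) p * (if z ∈ (p.1 + p.2).cluster x then 1 else 0) := by
  set D : Finset V := {x} ∆ ({y} ∆ ({z} ∆ {t})) with hD
  -- the three pair sums switched into `D`-sourced currents
  have hzt : D ∆ ({z} ∆ {t}) = {x} ∆ {y} := by
    rw [hD]; ext v; simp only [Finset.mem_symmDiff, Finset.mem_singleton]; tauto
  have hyt : D ∆ ({y} ∆ {t}) = {x} ∆ {z} := by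
    rw [hD]; ext v; simp only [Finset.mem_symmDiff, Finset.mem_singleton]; tauto
  have hyz : D ∆ ({y} ∆ {z}) = {x} ∆ {t} := by
    rw [hD]; ext v; simp only [Finset.mem_symmDiff, Finset.mem_singleton]; tauto
  have h1 : ecurrentSum K ({x} ∆ {y}) * ecurrentSum K ({z} ∆ {t}) =
      ∑' p : Current G × Current G, epairWeight K D ∅ p * (if t ∈ (p.1 + p.2).cluster z then 1 else 0) := by
    have h := tsum_epairWeight_switch_pair hK D z t (fun _ => 1)
    simp only [one_mul, mul_one, hzt] at h
    rw [← tsum_epairWeight, h]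
  have h2 : ecurrentSum K ({x} ∆ {z}) * ecurrentSum K ({y} ∆ {t}) =
      ∑' p : Current G × Current G, epairWeight K D ∅ p * (if t ∈ (p.1 + p.2).cluster y then 1 else 0) := by
    have h := tsum_epairWeight_switch_pair hK D y t (fun _ => 1)
    simp only [one_mul, mul_one, hyt] at h
    rw [← tsum_epairWeight, h]
  have h3 : ecurrentSum K ({x} ∆ {t}) * ecurrentSum K ({y} ∆ {z}) =
      ∑' p : Current G × Current G, epairWeight K D ∅ p * (if z ∈ (p.1 + p.2).cluster y then 1 else 0) := by
    have h := tsum_epairWeight_switch_pair hK D y z (fun _ => 1)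
    simp only [one_mul, mul_one, hyz] at h
    rw [← tsum_epairWeight, h]
  -- `P` switched into `D`-sourced currents
  have hP : ∑' p : Current G × Current G,
      epairWeight K ({x} ∆ {y}) ({z} ∆ {t}) p * (if z ∈ (p.1 + p.2).cluster x then 1 else 0) =
      ∑' p : Current G × Current G, epairWeight K D ∅ p *
        ((if z ∈ (p.1 + p.2).cluster x then 1 else 0) * (if t ∈ (p.1 + p.2).cluster z then 1 else 0)) := by
    have h := tsum_epairWeight_switch_pair hK D z t (fun m => if z ∈ m.cluster x then 1 else 0)
    rw [hzt] at h
    exact h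
  have h0 : ecurrentSum K D * ecurrentSum K ∅ = ∑' p : Current G × Current G, epairWeight K D ∅ p :=
    (tsum_epairWeight K D ∅).symm
  rw [h1, h2, h3, hP, h0, ← ENNReal.tsum_add, ← ENNReal.tsum_add, ← ENNReal.tsum_mul_left, ← ENNReal.tsum_add]
  refine tsum_congr fun p => ?_
  by_cases hp : p.1.sources = D ∧ p.2.sources = ∅
  · have hs : (p.1 + p.2).sources = {x} ∆ ({y} ∆ ({z} ∆ {t})) := by
      rw [sources_add, hp.1, hp.2, Finset.bot_eq_empty.symm, symmDiff_bot]
    rw [← mul_add, ← mul_add, ursell_indicator_identity_ennreal hs, mul_add, mul_one, mul_left_comm]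
  · simp only [epairWeight, if_neg hp, zero_mul, mul_zero, add_zero]

end Ursell

end Current

end Literature.Probability.LatticeModels

end
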